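import Mathlib
import Summits.CriticalPhenomena.Ising3DConformalLimit.Theorems.PrecisionLaplacianTwoPointSpineGlueLogConvex
import HarnessLib

/-!
# TwoPointSpineGlue (route PrecisionLaplacian, item stmt-CriticalPhenomena-4805) — the axial decrement bound

Helper file 9.  From the log-convexity of the even `W`-sequences (`…TwoPointSpineGlueLogConvex.logConvex_W`,
reflection positivity in a coordinate site mirror), the Messager–Miracle-Solé monotonicity and an upper
envelope `G(y) ≤ C₁‖y‖^{-s}`, the critical two-point function `G = criticalTwoPoint 3` has controlled
decrements along the axes, uniformly in the transverse coordinates: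

* `axis_decrement_le` — `0 ≤ G(w) − G(w + eᵢ) ≤ C₁ 8^{s+1} n^{-s-1}` whenever `wᵢ = n ≥ 4`.

(Aizenman–Duminil-Copin 2021 §5.5 / Duminil-Copin–Panis 2025 gradient device, elementary form.)
No definitions are introduced.
-/

noncomputable section

namespace Summit.CriticalPhenomena.Ising3DConformalLimit.Theorems.SpineGlue

open Finset Real Filter Topology Literature.Probability.LatticeModels

/-! ### The axial decrement bound -/

/-- **Axial decrement bound.** Suppose `G` is reflection positive for the coordinate mirror `θᵢ`
(two-point form), `G > 0`, and `G(y) ≤ C₁ ‖y‖^{-s}` off the origin with `s > 0`. Then for every `w`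
with `wᵢ = n ≥ 4`: `0 ≤ G(w) − G(w + eᵢ) ≤ C₁ 8^{s+1} n^{-s-1}`. -/
theorem axis_decrement_le {i : Fin 3}
    (hRP : ∀ (m : ℕ) (y : Fin m → Site 3) (c : Fin m → ℝ), (∀ a, 0 < y a i) →
      0 ≤ ∑ a, ∑ b, c a * c b * criticalTwoPoint 3 (y b - Function.update (y a) i (-(y a i))))
    (hGpos : ∀ x : Site 3, 0 < criticalTwoPoint 3 x)
    {C₁ s : ℝ} (hs : 0 < s) (hup : ∀ y : Site 3, y ≠ 0 → criticalTwoPoint 3 y ≤ C₁ * ‖y‖ ^ (-s))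
    (w : Site 3) {n : ℕ} (hn : 4 ≤ n) (hw : w i = n) :
    0 ≤ criticalTwoPoint 3 w - criticalTwoPoint 3 (w + Pi.single i 1) ∧
      criticalTwoPoint 3 w - criticalTwoPoint 3 (w + Pi.single i 1) ≤
        C₁ * 8 ^ (s + 1) * (n : ℝ) ^ (-(s + 1)) := by
  set G := criticalTwoPoint 3 with hGdef
  set e : Site 3 := Pi.single i 1 with he
  -- transverse part
  set z : Site 3 := w - (n : ℤ) • e with hzdef
  have hz : z i = 0 := by simp [hzdef, he, hw]
  have hw' : ∀ k : ℤ, w + k • e = (n + k : ℤ) • e + z := fun k => by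
    simp only [hzdef, add_smul]; abel
  have hw0 : w = (n : ℤ) • e + z := by have := hw' 0; simpa using this
  -- monotonicity along the axis at transverse offset `z`: `k ↦ G(k e + z)` non-increasing on `k ≥ 0`
  have hmonoG : ∀ (k : ℤ), 0 ≤ k → ∀ (p : ℕ), G ((k + p) • e + z) ≤ G (k • e + z) := by
    intro k hk p
    have h := criticalTwoPoint_add_single_le (k • e + z) i (by simp [he, hz, hk]) p
    have heq : k • e + z + Pi.single i (p : ℤ) = (k + p) • e + z := by
      rw [add_smul, he]
      have : (Pi.single i ((p : ℕ) : ℤ) : Site 3) = (p : ℤ) • (Pi.single i 1 : Site 3) := by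
        ext l; by_cases hl : l = i
        · subst hl; simp
        · simp [hl]
      rw [this]; abel
    rwa [heq] at h
  -- the sequence `U j = W(2j)`
  set U : ℕ → ℝ := fun j => 2 * G ((2 * (j : ℤ)) • e) + 2 * G ((2 * (j : ℤ)) • e + z) with hU
  have hUpos : ∀ j, 1 ≤ j → 0 < U j := fun j _ => by
    simp only [hU]; linarith [hGpos ((2 * (j : ℤ)) • e), hGpos ((2 * (j : ℤ)) • e + z)]
  have hUmono : ∀ j, 1 ≤ j → U (j + 1) ≤ U j := by
    intro j _
    simp only [hU]
    have h1 := hmonoG (2 * (j : ℤ)) (by positivity) 2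
    have h2 : G ((2 * (j : ℤ) + (2 : ℕ)) • e) ≤ G ((2 * (j : ℤ)) • e) := by
      have h := criticalTwoPoint_add_single_le ((2 * (j : ℤ)) • e) i (by simp [he]) 2
      have heq : (2 * (j : ℤ)) • e + Pi.single i ((2 : ℕ) : ℤ) = (2 * (j : ℤ) + (2 : ℕ)) • e := by
        rw [add_smul, he]
        have : (Pi.single i ((2 : ℕ) : ℤ) : Site 3) = ((2 : ℕ) : ℤ) • (Pi.single i 1 : Site 3) := by
          ext l; by_cases hl : l = i
          · subst hl; simp
          · simp [hl]
        rw [this]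
      rwa [heq] at h
    have hc : (2 * ((j + 1 : ℕ) : ℤ)) = 2 * (j : ℤ) + (2 : ℕ) := by push_cast; ring
    rw [hc]
    linarith
  have hUlc : ∀ j, 1 ≤ j → U (j + 1) ^ 2 ≤ U j * U (j + 2) := by
    intro j hj
    have h := logConvex_W hRP hGpos z hz (h := (j : ℤ)) (by exact_mod_cast hj)
    simp only [hU]
    have c1 : (2 * ((j + 1 : ℕ) : ℤ)) = 2 * ((j : ℤ) + 1) := by push_cast; ring
    have c2 : (2 * ((j + 2 : ℕ) : ℤ)) = 2 * ((j : ℤ) + 2) := by push_cast; ring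
    rw [c1, c2]
    exact h
  -- upper bound on `U j`
  have hUle : ∀ j, 1 ≤ j → U j ≤ 4 * C₁ * (2 * (j : ℝ)) ^ (-s) := by
    intro j hj
    have hzn : ∀ l, 0 ≤ (fun l => |((2 * (j : ℤ)) • e + z) l|) l := fun l => abs_nonneg _
    -- `G(2j e + z) ≤ G(2j e)` : reflect to nonnegative coordinates and zero the transverse ones
    have h1 : G ((2 * (j : ℤ)) • e + z) ≤ G ((2 * (j : ℤ)) • e) := by
      rw [hGdef, ← criticalTwoPoint_abs ((2 * (j : ℤ)) • e + z)]
      have h := criticalTwoPoint_le_single (fun l => |((2 * (j : ℤ)) • e + z) l|) hzn i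
      have heq : (Pi.single i ((fun l => |((2 * (j : ℤ)) • e + z) l|) i) : Site 3) = (2 * (j : ℤ)) • e := by
        ext l; by_cases hl : l = i
        · subst hl; simp [he, hz]
        · simp [hl, he]
      rwa [heq] at h
    have h2 : G ((2 * (j : ℤ)) • e) ≤ C₁ * (2 * (j : ℝ)) ^ (-s) := by
      have hne : (2 * (j : ℤ)) • e ≠ 0 := by
        intro h; have := congr_fun h i; simp [he] at this; omega
      have h := hup _ hne
      have hnorm : ‖(2 * (j : ℤ)) • e‖ = 2 * (j : ℝ) := by
        rw [Site.norm_eq_supNorm]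
        have : Site.supNorm ((2 * (j : ℤ)) • e) = 2 * j := by
          rw [Site.supNorm]
          apply le_antisymm
          · refine Finset.sup_le fun l _ => ?_
            by_cases hl : l = i
            · subst hl; simp [he]; omega
            · simp [hl, he]
          · have := Finset.le_sup (f := fun l => (((2 * (j : ℤ)) • e) l).natAbs) (Finset.mem_univ i)
            simp [he] at this ⊢; omega
        rw [this]; push_cast; ring
      rwa [hnorm] at h
    simp only [hU]
    linarith
  -- constants
  have hC₁ : 0 < C₁ := by
    have hne : (Pi.single i 1 : Site 3) ≠ 0 := by
      intro h; have := congr_fun h i; simp at this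
    have h := hup _ hne
    have hpos := hGpos (Pi.single i 1)
    have hr : 0 < ‖(Pi.single i 1 : Site 3)‖ ^ (-s) := Real.rpow_pos_of_pos (norm_pos_iff.2 hne) _
    nlinarith
  have hn0 : (0 : ℝ) < n := by exact_mod_cast (show 0 < n by omega)
  -- the key estimate for a pair `(m, j)` with `2j ≤ m ≤ 2j+1`, `2m ≤ n ≤ 2m+1`
  have key : ∀ m j : ℕ, 1 ≤ j → 2 * j ≤ m → m ≤ 2 * j + 1 → 2 * m ≤ n → n ≤ 2 * m + 1 →
      G ((2 * (m : ℤ)) • e + z) - G ((2 * (m : ℤ) + 2) • e + z) ≤ C₁ * 8 ^ (s + 1) * (n : ℝ) ^ (-(s + 1)) := by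
    intro m j hj1 hjm hmj hmn hnm
    have hjm' : j + 1 ≤ m := by omega
    -- `2 D ≤ U m - U (m+1)` (the axial part of `U` is non-increasing)
    have hax : G ((2 * (m : ℤ) + 2) • e) ≤ G ((2 * (m : ℤ)) • e) := by
      have h := criticalTwoPoint_add_single_le ((2 * (m : ℤ)) • e) i (by simp [he]) 2
      have heq : (2 * (m : ℤ)) • e + Pi.single i ((2 : ℕ) : ℤ) = (2 * (m : ℤ) + 2) • e := by
        rw [add_smul, he]
        have : (Pi.single i ((2 : ℕ) : ℤ) : Site 3) = (2 : ℤ) • (Pi.single i 1 : Site 3) := by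
          ext l; by_cases hl : l = i
          · subst hl; simp
          · simp [hl]
        rw [this]
      rwa [heq] at h
    have hUm : U (m + 1) = 2 * G ((2 * (m : ℤ) + 2) • e) + 2 * G ((2 * (m : ℤ) + 2) • e + z) := by
      simp only [hU]; push_cast; ring_nf
    have hD2 : 2 * (G ((2 * (m : ℤ)) • e + z) - G ((2 * (m : ℤ) + 2) • e + z)) ≤ U m - U (m + 1) := by
      rw [hUm]; simp only [hU]; linarith
    -- the decrement bound for `U`
    have hdec := decrement_le_of_logConvex hUpos hUmono hUlc hj1 hjm'
    have hUj := hUle j hj1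
    have hden : (0 : ℝ) < (m : ℝ) - j + 1 := by
      have : (j : ℝ) + 1 ≤ m := by exact_mod_cast hjm'
      linarith
    -- compare `(2j)^{-s}` with `n^{-s}` and `1/(m-j+1)` with `4/n`
    have hjpos : (0 : ℝ) < (j : ℝ) := by exact_mod_cast (show 0 < j from hj1)
    have hj0 : (0 : ℝ) < 2 * (j : ℝ) := by positivity
    have hA : (2 * (j : ℝ)) ^ (-s) ≤ 8 ^ s * (n : ℝ) ^ (-s) := by
      have h1 : (n : ℝ) / 8 ≤ 2 * (j : ℝ) := by
        rw [div_le_iff₀ (by norm_num : (0:ℝ) < 8)]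
        have : (n : ℝ) ≤ 2 * m + 1 := by exact_mod_cast hnm
        have : (m : ℝ) ≤ 2 * j + 1 := by exact_mod_cast hmj
        have : (4 : ℝ) ≤ n := by exact_mod_cast hn
        nlinarith
      have h2 := Real.rpow_le_rpow_of_nonpos (by positivity : (0 : ℝ) < n / 8) h1 (by linarith : -s ≤ 0)
      rw [Real.div_rpow hn0.le (by norm_num), Real.rpow_neg (by norm_num : (0:ℝ) ≤ 8), div_inv_eq_mul] at h2
      calc (2 * (j : ℝ)) ^ (-s) ≤ (n : ℝ) ^ (-s) * 8 ^ s := h2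
        _ = 8 ^ s * (n : ℝ) ^ (-s) := mul_comm _ _
    have hB : 1 / ((m : ℝ) - j + 1) ≤ 4 / n := by
      rw [div_le_div_iff₀ hden hn0, one_mul]
      have : (n : ℝ) ≤ 2 * m + 1 := by exact_mod_cast hnm
      have : (2 : ℝ) * j ≤ m := by exact_mod_cast hjm
      nlinarith
    have hpow : (n : ℝ) ^ (-(s + 1)) = (n : ℝ) ^ (-s) * (4 / n) / 4 := by
      rw [show -(s + 1) = -s + (-1) by ring, Real.rpow_add hn0, Real.rpow_neg_one]
      field_simp
    calc G ((2 * (m : ℤ)) • e + z) - G ((2 * (m : ℤ) + 2) • e + z)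
        ≤ (U m - U (m + 1)) / 2 := by linarith
      _ ≤ (U j / ((m : ℝ) - j + 1)) / 2 := by gcongr
      _ = U j * (1 / ((m : ℝ) - j + 1)) / 2 := by rw [mul_one_div]
      _ ≤ (4 * C₁ * (2 * (j : ℝ)) ^ (-s)) * (4 / n) / 2 := by gcongr
      _ ≤ (4 * C₁ * (8 ^ s * (n : ℝ) ^ (-s))) * (4 / n) / 2 := by gcongr
      _ = C₁ * (8 * 8 ^ s) * ((n : ℝ) ^ (-s) * (4 / n) / 4) := by ring
      _ = C₁ * 8 ^ (s + 1) * (n : ℝ) ^ (-(s + 1)) := by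
          rw [hpow, Real.rpow_add (by norm_num : (0:ℝ) < 8), Real.rpow_one, mul_comm (8 : ℝ)]
  -- nonnegativity and reduction to an even height
  have hwe : w + Pi.single i 1 = ((n : ℤ) + 1) • e + z := by
    have := hw' 1; rwa [one_smul] at this
  refine ⟨?_, ?_⟩
  · rw [hwe, hw0]
    have := hmonoG (n : ℤ) (by positivity) 1
    push_cast at this ⊢
    linarith
  obtain ⟨m, hm | hm⟩ := Nat.even_or_odd' n
  · -- even height `n = 2m`
    have hm2 : 2 ≤ m := by omega
    obtain ⟨j, hj | hj⟩ := Nat.even_or_odd' m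
    · have hk := key m j (by omega) (by omega) (by omega) (by omega) (by omega)
      have hred : G w - G (w + Pi.single i 1) ≤ G ((2 * (m : ℤ)) • e + z) - G ((2 * (m : ℤ) + 2) • e + z) := by
        rw [hwe, hw0, hm]
        have := hmonoG (2 * (m : ℤ) + 1) (by positivity) 1
        push_cast at this ⊢
        have e1 : (2 * (m : ℤ) + 1 + 1) = 2 * (m : ℤ) + 2 := by ring
        rw [e1] at this
        linarith
      exact hred.trans hk
    · have hk := key m j (by omega) (by omega) (by omega) (by omega) (by omega)
      have hred : G w - G (w + Pi.single i 1) ≤ G ((2 * (m : ℤ)) • e + z) - G ((2 * (m : ℤ) + 2) • e + z) := by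
        rw [hwe, hw0, hm]
        have := hmonoG (2 * (m : ℤ) + 1) (by positivity) 1
        push_cast at this ⊢
        have e1 : (2 * (m : ℤ) + 1 + 1) = 2 * (m : ℤ) + 2 := by ring
        rw [e1] at this
        linarith
      exact hred.trans hk
  · -- odd height `n = 2m + 1`
    have hm2 : 2 ≤ m := by omega
    obtain ⟨j, hj | hj⟩ := Nat.even_or_odd' m
    · have hk := key m j (by omega) (by omega) (by omega) (by omega) (by omega)
      have hred : G w - G (w + Pi.single i 1) ≤ G ((2 * (m : ℤ)) • e + z) - G ((2 * (m : ℤ) + 2) • e + z) := by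
        rw [hwe, hw0, hm]
        have := hmonoG (2 * (m : ℤ)) (by positivity) 1
        push_cast at this ⊢
        have e1 : (2 * (m : ℤ) + 1 + 1) = 2 * (m : ℤ) + 2 := by ring
        rw [e1]
        linarith
      exact hred.trans hk
    · have hk := key m j (by omega) (by omega) (by omega) (by omega) (by omega)
      have hred : G w - G (w + Pi.single i 1) ≤ G ((2 * (m : ℤ)) • e + z) - G ((2 * (m : ℤ) + 2) • e + z) := by
        rw [hwe, hw0, hm]
        have := hmonoG (2 * (m : ℤ)) (by positivity) 1
        push_cast at this ⊢
        have e1 : (2 * (m : ℤ) + 1 + 1) = 2 * (m : ℤ) + 2 := by ring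
        rw [e1]
        linarith
      exact hred.trans hk

end Summit.CriticalPhenomena.Ising3DConformalLimit.Theorems.SpineGlue

end
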